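import Literature.IUT.LogVolume.FiniteProbability
import Literature.IUT.LogVolume.ArakelovDivisors
import Mathlib.Tactic.FieldSimp
import Mathlib.Tactic.Ring
import Mathlib.Tactic.Linarith
import HarnessLib

/-!
# lgp-divisors and the `q`-pilot and Θ-pilot divisors of an elliptic curve (Dupuy–Hilado, *The statement of
# Mochizuki's Corollary 3.12*, Def. 3.1.1, §3.2–§3.3)

Dupuy–Hilado, arXiv:2004.13228 (pre-split text; Ramanujan J. **68** (2025)), read on the page
(corpus render `paper:arxiv-2004.13228`, chunk 8):

* Def. 3.1.1: "Let `r` be a natural number. An lgp-divisor [lgp stands for Log Gaussian Procession]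
  for a number field `L` is a tuple `(P_j)_{j=1}^{r}` where `P_j ∈ Div̂(L)_ℚ`. The degree of an
  lgp-divisor is simply the uniform average of the degrees of its components:
  `deĝ_lgp(P) = (1/r) Σ_{j=1}^{r} deĝ_L(P_j) = 𝔼(deĝ_L(P_j) : 1 ≤ j ≤ r)`."
* §3.2: "for all elliptic curves `A` over a field `L`, a finite extension of `ℚ_p`, with `|j_A|_L > 1`
  we have an isomorphism `A(L̄) ≅ E_q(L̄)` where `E_q` is the Tate curve for some unique `q ∈ L̄`
  called the Tate parameter (a geometric invariant which can be written as a formal power series in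
  `1/j_E` with integer coefficients)."
* §3.3: "Let `E` be an elliptic curve over a number field `F` and let `S ⊂ V(ℚ(j_E))` be a non-empty
  collection of places of bad multiplicative reduction … Tate parameter `q_v` at all places `v ∈ S`.
  After fixing `l` a prime number we let `q̲_v = q_v^{1/2l}` be a choice of `2l`th root. The
  `q`-pilot divisor associated to `(E,S,l)` is then `P_q := Σ_{v∈S} ord_v(q̲_v)[v] ∈ Div̂(ℚ(j_E))_ℚ`.
  … The theta pilot divisor is the lgp-divisor `P_Θ = (P_{Θ,j})_{j=1}^{(l−1)/2} ∈ Div_lgp(ℚ(j_E))_ℚ`,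
  where `P_{Θ,j} = Σ_{v∈S} ord_v(q̲_v^{j²})[v]`."

What this file DEFINES (on Mathlib, over `ArakelovDivisors`): lgp-divisors of length `r` over a
number field `F` with their lgp-degree (and its reading as a uniform expectation,
`FiniteProbability`); the PILOT DATA `(F, j_E, S, l)` — the field (playing Dupuy–Hilado's `ℚ(j_E)`),
the `j`-invariant `j_E ∈ F`, a non-empty finite set `S` of finite places with `ord_v(j_E) < 0`, and a
prime `l ≥ 5` ([IUTchI] Def. 3.1 (c)); and from it the `q`-pilot divisor and the theta-pilot
lgp-divisor. MODELLING CHOICE, stated once: the only property of the Tate parameter the divisors use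
is its valuation, and by the sentence of §3.2 quoted above (`q_v` is a power series in `1/j_E` with
integer coefficients and leading term `1/j_E`) `ord_v(q_v) = −ord_v(j_E) > 0` at a place with
`ord_v(j_E) < 0`; we therefore DEFINE `ordq v := −ord_v(j_E)` and never touch Tate uniformisation
(a named FACT elsewhere in the cell). Then the dictionary identities are THEOREMS of the definitions:
`P_{Θ,j} = j²·P_q` (`thetaPilot_eq_smul`), `deĝ(P_q) = (1/2l)·deĝ(𝔮)` with `𝔮 := Σ_{v∈S} ord_v(q_v)[v]`
the divisor of the Tate parameters (`deg_qPilot`), `deĝ_lgp(P_Θ) = ((ℓ⋇+1)(2ℓ⋇+1)/6)·deĝ(P_q)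
= ((l+1)/24)·deĝ(𝔮)` (`degLgp_thetaPilot`, `degLgp_thetaPilot_closed`; the coefficient `(l+1)/24` is
the one printed in [IUTchIV] Thm. 1.10, Step (v)), and `0 < deĝ(P_q) < deĝ_lgp(P_Θ)`.

Deliberately NOT here: Tate curves/uniformisation, the region `O_𝕃(−P_Θ)` of Rmk. 3.3.1 and the
degree/volume conversion Thm. 3.10.1 (see `DegreeVolumeConversion`), initial theta data in full
(Def. 5.3.1), anything disputed.
-/

noncomputable section

namespace Literature.IUT.LogVolume

open NumberField IsDedekindDomain Finset

variable (F : Type*) [Field F] [NumberField F]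

/-! ## lgp-divisors (Def. 3.1.1) -/

/-- An lgp-divisor of length `r` for the number field `F`: a tuple `(P_j)_{j=1}^r` of divisors (finite
part, real coefficients; index `j : Fin r` stands for `j+1 ∈ {1,…,r}`).
[cite: DupuyHilado2025, Def. 3.1.1] -/
abbrev LgpDivisor (r : ℕ) : Type _ := Fin r → FinDivisor F

namespace LgpDivisor

variable {F} {r : ℕ}

/-- The lgp-degree `deĝ_lgp(P) = (1/r) Σ_{j=1}^r deĝ_F(P_j)` ("simply the uniform average of the
degrees of its components"). [cite: DupuyHilado2025, Def. 3.1.1] -/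
def degLgp (P : LgpDivisor F r) : ℝ := (1 / (r : ℝ)) * ∑ j, FinDivisor.deg F (P j)

/-- The normalised lgp-degree `deĝ̲_lgp(P) = (1/r) Σ_j deĝ̲_F(P_j) = deĝ_lgp(P)/[F:ℚ]`.
[cite: DupuyHilado2025, Def. 3.1.1, §2.5.4] -/
def ndegLgp (P : LgpDivisor F r) : ℝ := (1 / (r : ℝ)) * ∑ j, FinDivisor.ndeg F (P j)

/-- `deĝ̲_lgp(P) = deĝ_lgp(P)/[F:ℚ]`. [cite: DupuyHilado2025, Def. 3.1.1, §2.5.4] -/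
theorem ndegLgp_eq (P : LgpDivisor F r) : ndegLgp P = degLgp P / Module.finrank ℚ F := by
  simp only [ndegLgp, degLgp, FinDivisor.ndeg_apply, ← Finset.sum_div]
  ring

/-- `deĝ_lgp(P) = 𝔼(deĝ_F(P_j) : 1 ≤ j ≤ r)`, the expectation for the uniform probability space on
the indices. [cite: DupuyHilado2025, Def. 3.1.1] -/
theorem degLgp_eq_expect [NeZero r] (P : LgpDivisor F r) :
    degLgp P = (ProbWeights.uniform (Fin r)).expect (fun j => FinDivisor.deg F (P j)) := by
  rw [ProbWeights.expect_uniform, Fintype.card_fin, degLgp]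

/-- A constant lgp-divisor `(D, …, D)` (`r ≥ 1`) has lgp-degree `deĝ(D)`.
[cite: DupuyHilado2025, Def. 3.1.1] -/
theorem degLgp_const [NeZero r] (D : FinDivisor F) : degLgp (fun _ : Fin r => D) = FinDivisor.deg F D := by
  have hr : (r : ℝ) ≠ 0 := by exact_mod_cast NeZero.ne r
  simp only [degLgp, Finset.sum_const, Finset.card_univ, Fintype.card_fin, nsmul_eq_mul]
  field_simp

/-- lgp-degree is additive. [cite: DupuyHilado2025, Def. 3.1.1] -/
theorem degLgp_add (P Q : LgpDivisor F r) : degLgp (P + Q) = degLgp P + degLgp Q := by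
  simp only [degLgp, Pi.add_apply, map_add, Finset.sum_add_distrib]
  ring

/-- lgp-degree is homogeneous. [cite: DupuyHilado2025, Def. 3.1.1] -/
theorem degLgp_smul (c : ℝ) (P : LgpDivisor F r) : degLgp (c • P) = c * degLgp P := by
  simp only [degLgp, Pi.smul_apply, map_smul, smul_eq_mul, ← Finset.mul_sum]
  ring

end LgpDivisor

/-! ## Pilot data `(F, j_E, S, l)` and the pilot divisors (§3.3) -/

/-- The data of §3.3 from which the pilot divisors are built: the number field `F` (Dupuy–Hilado's
`ℚ(j_E)`), the `j`-invariant `j_E ∈ F` of the elliptic curve, a NON-EMPTY finite set `S` of finite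
places at which `ord_v(j_E) < 0` ("places of bad multiplicative reduction" — potentially
multiplicative reduction is `ord_v(j_E) < 0`, and over the fields of initial theta data the reduction
is split multiplicative, [IUTchI] Def. 3.1 (b)), and the prime `l ≥ 5` ("fixing `l` a prime number";
`l ≥ 5` is [IUTchI] Def. 3.1 (c)). [cite: DupuyHilado2025, §3.3] -/
structure PilotData where
  /-- the `j`-invariant `j_E ∈ F` -/
  jE : F
  /-- the chosen bad places `S ⊂ V(F)_0` -/
  S : Finset (HeightOneSpectrum (𝓞 F))
  /-- `S` is non-empty -/
  S_nonempty : S.Nonempty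
  /-- bad multiplicative reduction at every `v ∈ S`: `ord_v(j_E) < 0` -/
  ord_jE_neg : ∀ v ∈ S, ord F v jE < 0
  /-- the auxiliary prime `l` -/
  l : ℕ
  /-- `l` is prime -/
  l_prime : l.Prime
  /-- `l ≥ 5` -/
  five_le_l : 5 ≤ l

namespace PilotData

variable {F} (X : PilotData F)

/-- `j_E ≠ 0` (it has negative valuation somewhere). [cite: DupuyHilado2025, §3.3] -/
theorem jE_ne_zero : X.jE ≠ 0 := by
  obtain ⟨v, hv⟩ := X.S_nonempty
  intro h
  have := X.ord_jE_neg v hv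
  rw [h, ord_zero] at this
  exact lt_irrefl _ this

/-- `ℓ⋇ := (l−1)/2`, the number of components of the theta pilot. [cite: DupuyHilado2025, §3.3] -/
def lstar : ℕ := (X.l - 1) / 2

/-- `l` is odd (a prime `≥ 5`), so `l = 2ℓ⋇ + 1`. [cite: DupuyHilado2025, §3.3] -/
theorem l_eq : X.l = 2 * X.lstar + 1 := by
  have h5 := X.five_le_l
  have hodd : ¬ 2 ∣ X.l := by
    intro h
    rcases X.l_prime.eq_one_or_self_of_dvd 2 h with h | h <;> omega
  unfold lstar
  omega

/-- `ℓ⋇ ≥ 2` (since `l ≥ 5`). [cite: DupuyHilado2025, §3.3] -/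
theorem two_le_lstar : 2 ≤ X.lstar := by
  have := X.l_eq
  have := X.five_le_l
  omega

/-- `l` as a real number is `2ℓ⋇+1`, in particular positive. [cite: DupuyHilado2025, §3.3] -/
theorem l_cast : (X.l : ℝ) = 2 * X.lstar + 1 := by
  rw [X.l_eq]; push_cast; ring

/-- `0 < 2l` as reals. [cite: DupuyHilado2025, §3.3] -/
theorem two_mul_l_pos : (0 : ℝ) < 2 * X.l := by
  rw [X.l_cast]; positivity

/-- `ord_v(q_v)`, the valuation of the Tate parameter at `v ∈ S`, DEFINED as `−ord_v(j_E)` (by §3.2,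
`q_v` is an integral power series in `1/j_E` with leading term `1/j_E`). [cite: DupuyHilado2025, §3.2–3.3] -/
def ordq (v : HeightOneSpectrum (𝓞 F)) : ℤ := -ord F v X.jE

/-- `ord_v(q_v) > 0` at the bad places. [cite: DupuyHilado2025, §3.3] -/
theorem ordq_pos {v : HeightOneSpectrum (𝓞 F)} (hv : v ∈ X.S) : 0 < X.ordq v := by
  have := X.ord_jE_neg v hv
  unfold ordq
  omega

/-- The divisor of the Tate parameters over `S`: `𝔮 := Σ_{v∈S} ord_v(q_v)[v]` (the arithmetic
divisor whose normalised degree is [IUTchIV]'s `log(q)`; `P_q = (1/2l)·𝔮`). [cite: DupuyHilado2025, §3.3] -/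
def qDivisor : FinDivisor F := ∑ v ∈ X.S, FinDivisor.of v (X.ordq v : ℝ)

/-- **The `q`-pilot divisor** `P_q := Σ_{v∈S} ord_v(q̲_v)[v]`, `q̲_v = q_v^{1/2l}`, i.e. coefficient
`ord_v(q_v)/(2l)` at `v ∈ S`. [cite: DupuyHilado2025, §3.3] -/
def qPilot : FinDivisor F := ∑ v ∈ X.S, FinDivisor.of v ((X.ordq v : ℝ) / (2 * X.l))

/-- **The theta-pilot lgp-divisor** `P_Θ = (P_{Θ,j})_{j=1}^{ℓ⋇}`, `P_{Θ,j} = Σ_{v∈S} ord_v(q̲_v^{j²})[v]`,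
i.e. coefficient `j²·ord_v(q_v)/(2l)` at `v ∈ S` (index `i : Fin ℓ⋇` stands for `j = i+1`).
[cite: DupuyHilado2025, §3.3] -/
def thetaPilot : LgpDivisor F X.lstar :=
  fun i => ∑ v ∈ X.S, FinDivisor.of v ((((i : ℕ) + 1 : ℝ) ^ 2) * (X.ordq v : ℝ) / (2 * X.l))

/-- `P_q = (1/2l)·𝔮`. [cite: DupuyHilado2025, §3.3] -/
theorem qPilot_eq_smul : X.qPilot = (1 / (2 * (X.l : ℝ))) • X.qDivisor := by
  simp only [qPilot, qDivisor, Finset.smul_sum, FinDivisor.of, Finsupp.smul_single, smul_eq_mul]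
  refine Finset.sum_congr rfl fun v _ => ?_
  congr 1
  ring

/-- `P_{Θ,j} = j²·P_q` (the `j`-th theta pilot is the `q`-pilot scaled by `j²`).
[cite: DupuyHilado2025, §3.3] -/
theorem thetaPilot_eq_smul (i : Fin X.lstar) :
    X.thetaPilot i = (((i : ℕ) + 1 : ℝ) ^ 2) • X.qPilot := by
  simp only [thetaPilot, qPilot, Finset.smul_sum, FinDivisor.of, Finsupp.smul_single, smul_eq_mul]
  refine Finset.sum_congr rfl fun v _ => ?_
  congr 1
  ring

/-- `deĝ(𝔮) = Σ_{v∈S} ord_v(q_v)·ln|κ(v)|`. [cite: DupuyHilado2025, §3.3, §2.5.4] -/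
theorem deg_qDivisor : FinDivisor.deg F X.qDivisor = ∑ v ∈ X.S, (X.ordq v : ℝ) * logNorm F v :=
  FinDivisor.deg_sum_of X.S id _

/-- `deĝ(𝔮) > 0` (non-empty `S`, positive valuations, `ln|κ(v)| > 0`).
[cite: DupuyHilado2025, §3.3] -/
theorem deg_qDivisor_pos : 0 < FinDivisor.deg F X.qDivisor := by
  rw [deg_qDivisor]
  apply Finset.sum_pos _ X.S_nonempty
  intro v hv
  exact mul_pos (by exact_mod_cast X.ordq_pos hv) (logNorm_pos F v)

/-- `deĝ(P_q) = (1/2l)·deĝ(𝔮)` — "`|log(q)|` … is equal to `(1/2l)·log(q)`" ([IUTchIV] Thm. 1.10) in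
divisor form. [cite: DupuyHilado2025, §3.3] -/
theorem deg_qPilot : FinDivisor.deg F X.qPilot = (1 / (2 * (X.l : ℝ))) * FinDivisor.deg F X.qDivisor := by
  rw [qPilot_eq_smul, map_smul, smul_eq_mul]

/-- `deĝ(P_q) > 0`. [cite: DupuyHilado2025, §3.3] -/
theorem deg_qPilot_pos : 0 < FinDivisor.deg F X.qPilot := by
  rw [deg_qPilot]
  exact mul_pos (by have := X.two_mul_l_pos; positivity) X.deg_qDivisor_pos

/-- `deĝ(P_{Θ,j}) = j²·deĝ(P_q)`. [cite: DupuyHilado2025, §3.3] -/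
theorem deg_thetaPilot (i : Fin X.lstar) :
    FinDivisor.deg F (X.thetaPilot i) = (((i : ℕ) + 1 : ℝ) ^ 2) * FinDivisor.deg F X.qPilot := by
  rw [thetaPilot_eq_smul, map_smul, smul_eq_mul]

/-- Plumbing: `Σ_{i<n} (i+1)² = n(n+1)(2n+1)/6` over `ℝ`. [folklore] -/
private theorem sum_succ_sq (n : ℕ) :
    ∑ i ∈ range n, (((i : ℕ) : ℝ) + 1) ^ 2 = (n : ℝ) * (n + 1) * (2 * n + 1) / 6 := by
  induction n with
  | zero => simp
  | succ n ih =>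
    rw [Finset.sum_range_succ, ih]
    push_cast
    ring

/-- **`deĝ_lgp(P_Θ) = ((ℓ⋇+1)(2ℓ⋇+1)/6)·deĝ(P_q)`**: the lgp-degree of the theta pilot is the AVERAGE
of the weights `j²`, `j = 1, …, ℓ⋇`, times the `q`-pilot degree. [cite: DupuyHilado2025, Def. 3.1.1, §3.3] -/
theorem degLgp_thetaPilot :
    LgpDivisor.degLgp X.thetaPilot =
      (((X.lstar : ℝ) + 1) * (2 * X.lstar + 1) / 6) * FinDivisor.deg F X.qPilot := by
  have hn : (X.lstar : ℝ) ≠ 0 := by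
    have := X.two_le_lstar; exact_mod_cast (by omega : X.lstar ≠ 0)
  simp only [LgpDivisor.degLgp, deg_thetaPilot, ← Finset.sum_mul]
  rw [Fin.sum_univ_eq_sum_range (fun i => ((i : ℝ) + 1) ^ 2) X.lstar, sum_succ_sq]
  field_simp

/-- … in closed form: `deĝ_lgp(P_Θ) = ((l+1)/24)·deĝ(𝔮)` — the coefficient
"`(2ℓ⋇+1)(ℓ⋇+1)/(12l) = (l+1)/24`" printed in [IUTchIV] Thm. 1.10, Step (v).
[cite: DupuyHilado2025, Def. 3.1.1, §3.3] -/
theorem degLgp_thetaPilot_closed :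
    LgpDivisor.degLgp X.thetaPilot = (((X.l : ℝ) + 1) / 24) * FinDivisor.deg F X.qDivisor := by
  rw [degLgp_thetaPilot, deg_qPilot, X.l_cast]
  have h : (2 : ℝ) * (2 * X.lstar + 1) ≠ 0 := by positivity
  field_simp
  ring

/-- The average weight exceeds one: `(ℓ⋇+1)(2ℓ⋇+1)/6 > 1` for `ℓ⋇ ≥ 2`.
[cite: DupuyHilado2025, §3.3] -/
theorem one_lt_avgWeight : 1 < ((X.lstar : ℝ) + 1) * (2 * X.lstar + 1) / 6 := by
  have h2 : (2 : ℝ) ≤ X.lstar := by exact_mod_cast X.two_le_lstar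
  nlinarith

/-- **`deĝ(P_q) < deĝ_lgp(P_Θ)`** — the two pilot degrees are different real numbers, the theta
side being the larger degree (smaller region). [cite: DupuyHilado2025, §3.3] -/
theorem deg_qPilot_lt_degLgp_thetaPilot :
    FinDivisor.deg F X.qPilot < LgpDivisor.degLgp X.thetaPilot := by
  rw [degLgp_thetaPilot]
  have hq := X.deg_qPilot_pos
  have hw := X.one_lt_avgWeight
  nlinarith

/-- The gap in closed form: `deĝ_lgp(P_Θ) − deĝ(P_q) = ((l+1)/24 − 1/(2l))·deĝ(𝔮)`.
[cite: DupuyHilado2025, §3.3] -/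
theorem degLgp_thetaPilot_sub_deg_qPilot :
    LgpDivisor.degLgp X.thetaPilot - FinDivisor.deg F X.qPilot =
      (((X.l : ℝ) + 1) / 24 - 1 / (2 * X.l)) * FinDivisor.deg F X.qDivisor := by
  rw [degLgp_thetaPilot_closed, deg_qPilot]
  ring

/-- Replacing every component of the theta pilot by `P_q` gives lgp-degree `deĝ(P_q)`.
[cite: DupuyHilado2025, Def. 3.1.1, §3.3] -/
theorem degLgp_const_qPilot :
    LgpDivisor.degLgp (fun _ : Fin X.lstar => X.qPilot) = FinDivisor.deg F X.qPilot := by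
  haveI : NeZero X.lstar := ⟨by have := X.two_le_lstar; omega⟩
  exact LgpDivisor.degLgp_const _

end PilotData

end Literature.IUT.LogVolume

end
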